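import Summits.HodgeConjecture.HodgeConjecture.Theorems.AnchorTransportVariationalHodgePadicGenericPropagationProper
import Literature.AlgebraicGeometry.HodgeTheory.NonGenericComplexPointsCountable
import Literature.AlgebraicGeometry.HodgeTheory.ComplexPointsLifting

/-!
# Route PadicSemiregularLift — support item `HodgeLocusPropagation` (stmt-HodgeConjecture-14977):
# from algebraicity at the complex points over the generic point to algebraicity EVERYWHERE,
# through a Mumford curve and countable-subfield descent

HONEST FRAMING: research route conditional on HC_CM; not a corollary; Q11.4-sentence-2 already refuted in dim ≥ 3.
Helper file (nothing here closes an item; no definition, no named fact, no `sorry`; `HC_CM` does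
not occur). Cell `pub-hodge-ring2`, binder seat `ring2-b03` (gen 42).

Setting: `k` countable algebraically closed, `σ : k →+* ℂ`, `f₀ : 𝒳₀ ⟶ S₀` over `k` with `S₀`
integral, quasi-compact and locally of finite type (ANY dimension, possibly singular), whose
complexification `f : 𝒳 ⟶ S` is a smooth projective family of relative dimension `n` (no
quasi-projectivity of the total space), and `A ∈ H²ᵖ(𝒳(ℂ); ℂ)` ALGEBRAIC ON EVERY FIBRE OVER A
COMPLEX POINT LYING OVER THE GENERIC POINT of `S₀` (the output of
`mem_algebraicClasses_of_base_pt_eq_genericPoint_of_base_pt_eq_genericPoint`).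

* `mem_algebraicClasses_of_forall_base_pt_eq_genericPoint` — **then `A|_{𝒳_u}` is algebraic at
  EVERY complex point `u` of `S`.** Proof: `S = S₀ ⊗ ℂ` is integral (`k = k̄`); pick a complex point
  `s` over the generic point (`exists_base_pt_eq`); MUMFORD'S CURVE LEMMA for integral varieties
  (`mumford_smoothCurve_through_two_points_of_isIntegral`, no smoothness of `S`) gives a smooth
  irreducible affine curve `γ : C → S` through `u` and `s`; pull the family back to `C`
  (`familyPullback`; fibres `(𝒳 ×_S C)_c ≅ 𝒳_{γ c}`). The pulled-back family is, up to an
  isomorphism of families, the complexification of a family `f₁ : 𝒳₁ ⟶ C₁` over a COUNTABLE field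
  `k₁` (`Limits.exists_countable_subfield_descent`, EGA IV₃ 8.8.2 (ii); transport lemmas of
  `AnchorTransportVariationalHodgePadicDescent`). Counting on the uncountable `C(ℂ)`: the complex
  points NOT Weil-generic over `k₁` are countable (`countable_setOf_not_weilGeneric_of_complexification`),
  and so are those whose image in `S` is NOT over the generic point of `S₀` (a countable union over
  the points `x ≠ η` of `S₀` — `countable_of_locallyOfFiniteType` — of the complex points over the
  proper closed subsets `γ⁻¹(S ×_{S₀} \overline{x})` of the curve, each finite,
  `finite_setOf_pt_mem_of_isClosed_of_ne_univ`); hence some `c⋆ ∈ C(ℂ)` is `k₁`-generic with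
  `γ(c⋆)` over `η_{S₀}`, where `A` is algebraic by hypothesis. The binder seat's gen-34 theorem
  `everywherePropagation` (curve base over a countable field, one algebraic fibre over the generic
  point ⟹ all fibres) then gives algebraicity at the point of `C` over `u`.

References: [MumfordAV1970] §6 Lemma; [VoisinHodgeII2003] §3.3.1; [CharlesSchnell2014Notes]
Prop. 11.3.11 (proof), Lemma 11.3.14; [EGAIV3] Thm. 8.8.2 (ii).
-/

noncomputable section

-- every declaration of this problem lives in `Summit.HodgeConjecture.HodgeConjecture.…` (summit = sub-problem)
set_option linter.dupNamespace false

open CategoryTheory CategoryTheory.Limits AlgebraicGeometry TopologicalSpace Order Cardinal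
open Literature.AlgebraicGeometry.Motives Literature.AlgebraicGeometry.HodgeTheory
open Literature.AlgebraicGeometry.Limits

namespace Summit.HodgeConjecture.HodgeConjecture.Theorems

/-- **From the complex points over the generic point to every complex point — any integral base,
no quasi-projectivity of the total space.** Let `k` be countable algebraically closed,
`σ : k →+* ℂ`, `f₀ : 𝒳₀ ⟶ S₀` over `k` with `S₀` integral, quasi-compact and locally of finite
type, whose complexification `f : 𝒳 ⟶ S` is a smooth projective family of relative dimension `n`,
and `A ∈ H²ᵖ(𝒳(ℂ); ℂ)` algebraic on `𝒳_v` for every complex point `v` of `S` over the generic point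
of `S₀`. Then `A|_{𝒳_u}` is algebraic for EVERY complex point `u` of `S` (module docstring: Mumford
curve through `u` and a point over the generic point, countable-subfield descent of the pulled-back
family, a `k₁`-generic point of the curve with image over `η_{S₀}` by counting, then
`everywherePropagation`). [cite: MumfordAV1970, §6, Lemma] [cite: VoisinHodgeII2003, §3.3.1]
[cite: CharlesSchnell2014Notes, Prop. 11.3.11 (proof) and Lemma 11.3.14] [cite: EGAIV3, Thm. 8.8.2 (ii)] -/
theorem mem_algebraicClasses_of_forall_base_pt_eq_genericPoint
    (k : Type) [Field k] [Countable k] [IsAlgClosed k] (σ : k →+* ℂ) ⦃n : ℕ⦄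
    ⦃𝒳₀ S₀ : SchemeOver k⦄ (f₀ : 𝒳₀ ⟶ S₀) [IsIntegral S₀.left] [LocallyOfFiniteType S₀.hom]
    [CompactSpace S₀.left]
    (hf : IsSmoothProjectiveFamily ((baseChangeHom σ).map f₀) n)
    (p : ℕ) (A : complexBetti ((baseChangeHom σ).obj 𝒳₀) (2 * p))
    (hgen : ∀ v : ComplexPoints ((baseChangeHom σ).obj S₀),
      (baseChangeHomFst σ S₀).base v.pt = genericPoint S₀.left →
        complexBetti.map (fiberι ((baseChangeHom σ).map f₀) v) (2 * p) A ∈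
          algebraicClasses (fiberOver ((baseChangeHom σ).map f₀) v) p)
    (u : ComplexPoints ((baseChangeHom σ).obj S₀)) :
    complexBetti.map (fiberι ((baseChangeHom σ).map f₀) u) (2 * p) A ∈
      algebraicClasses (fiberOver ((baseChangeHom σ).map f₀) u) p := by
  classical
  letI := σ.toAlgebra
  haveI : CharZero k := σ.charZero
  have hK : #k ≤ ℵ₀ := Cardinal.mk_le_aleph0
  -- ### notation and standing instances
  let 𝒳 : SchemeOver ℂ := (baseChangeHom σ).obj 𝒳₀
  let S : SchemeOver ℂ := (baseChangeHom σ).obj S₀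
  let f : 𝒳 ⟶ S := (baseChangeHom σ).map f₀
  let prS : S.left ⟶ S₀.left := baseChangeHomFst σ S₀
  haveI : IsProper f.left := hf.isProper
  have hGI : GeometricallyIntegral S₀.hom := geometricallyIntegral_of_isAlgClosed S₀.hom
  haveI : GeometricallyIntegral S.hom := by
    change GeometricallyIntegral (pullback.snd S₀.hom (Spec.map (CommRingCat.ofHom σ)))
    exact MorphismProperty.pullback_snd (P := @GeometricallyIntegral) _ _ hGI
  haveI : IsIntegral S.left := GeometricallyIntegral.isIntegral_of_subsingleton S.hom
  haveI : LocallyOfFiniteType S.hom := by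
    change LocallyOfFiniteType (pullback.snd S₀.hom (Spec.map (CommRingCat.ofHom σ)))
    infer_instance
  -- ### a complex point `s` over the generic point, and a Mumford curve through `u` and `s`
  obtain ⟨s, hs⟩ := exists_base_pt_eq σ S₀ hK (genericPoint S₀.left)
  obtain ⟨C, γ, a', b', hCaff, hCirr, hCsm, hCdim, ha', hb'⟩ :=
    mumford_smoothCurve_through_two_points_of_isIntegral (X := S) u s
  haveI := hCaff
  haveI := hCirr
  haveI := hCsm
  haveI : IsIntegral C.left := isIntegral_of_irreducibleSpace_of_smooth C
  haveI : SmoothOfRelativeDimension 1 C.hom :=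
    Ring2.Hypotheses.smoothOfRelativeDimension_one_of_topologicalKrullDim C hCdim
  haveI : IsAffineHom C.hom := isAffineHom_of_isAffine C.hom
  haveI : IsSeparated C.hom := inferInstance
  haveI : QuasiCompact C.hom := inferInstance
  haveI : LocallyOfFiniteType C.hom := inferInstance
  -- ### the family pulled back to `C`
  let 𝒲 : SchemeOver ℂ := familyPullback f γ
  let fC : 𝒲 ⟶ C := familyPullback.snd f γ
  let qC : 𝒲 ⟶ 𝒳 := familyPullback.fst f γ
  have hfC : IsSmoothProjectiveFamily fC n := hf.familyPullback_snd γ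
  haveI : IsProper fC.left := hfC.isProper
  let AC : complexBetti 𝒲 (2 * p) := complexBetti.map qC (2 * p) A
  -- algebraicity on the fibres of `fC` is algebraicity on the fibres of `f` at the image points
  have hfib : ∀ c : ComplexPoints C,
      complexBetti.map (fiberι fC c) (2 * p) AC ∈ algebraicClasses (fiberOver fC c) p ↔
        complexBetti.map (fiberι f (AlgPoints.map γ c)) (2 * p) A ∈
          algebraicClasses (fiberOver f (AlgPoints.map γ c)) p := by
    intro c
    rw [show complexBetti.map (fiberι fC c) (2 * p) AC =
        complexBetti.map (fiberOverFamilyPullbackIso f γ c).hom (2 * p)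
          (complexBetti.map (fiberι f (AlgPoints.map γ c)) (2 * p) A) from
      map_fiberι_map_eq_map_of_fiberIso f qC fC (fiberOverFamilyPullbackIso f γ c)
        (fiberOverFamilyPullbackIso_hom_fiberι f γ c) (2 * p) A]
    exact mem_algebraicClasses_map_iff_of_iso (fiberOverFamilyPullbackIso f γ c)
  -- ### descent of the pulled-back family to a countable subfield
  obtain ⟨k₁, _, _, σ₁, 𝒳₁, C₁, f₁, e𝒳, eC, hcomm⟩ := exists_countable_subfield_descent fC
  letI := σ₁.toAlgebra
  let C' : SchemeOver ℂ := (baseChangeHom σ₁).obj C₁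
  let prC : C'.left ⟶ C₁.left := baseChangeHomFst σ₁ C₁
  have hf₁ : IsSmoothProjectiveFamily ((baseChangeHom σ₁).map f₁) n :=
    IsSmoothProjectiveFamily.of_arrowIso e𝒳 eC hcomm hfC
  obtain ⟨hirr', haff', hsm', hdim'⟩ := base_hypotheses_of_iso (S' := C') eC hCdim
  haveI := hirr'
  haveI := haff'
  haveI := hsm'
  haveI : IsIntegral C'.left := isIntegral_of_irreducibleSpace_of_smooth C'
  haveI : SmoothOfRelativeDimension 1 C'.hom :=
    Ring2.Hypotheses.smoothOfRelativeDimension_one_of_topologicalKrullDim C' hdim'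
  haveI : LocallyOfFiniteType C'.hom := inferInstance
  haveI : IsNoetherian C'.left := {}
  haveI : IrreducibleSpace C₁.left := irreducibleSpace_of_baseChangeHom σ₁ C₁
  let A₁ : complexBetti ((baseChangeHom σ₁).obj 𝒳₁) (2 * p) := complexBetti.map e𝒳.hom (2 * p) AC
  -- the composite `C' ≅ C → S` and the point of `C'` mapping to `s`
  let δ : C' ⟶ S := eC.hom ≫ γ
  let c₀ : ComplexPoints C' := AlgPoints.map eC.inv b'
  have hc₀ : AlgPoints.map δ c₀ = s := by
    change AlgPoints.map (eC.hom ≫ γ) (AlgPoints.map eC.inv b') = s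
    rw [AlgPoints.map_comp_apply, AlgPoints.map_hom_map_inv_apply, hb']
  -- ### counting: the bad complex points of `C'` are countable
  -- (1) not Weil-generic over `k₁`
  have hbad₁ : {c : ComplexPoints C' | ¬ ∀ Z : Set (ComplexPoints C'),
      IsDefinedOver σ₁ C₁ σ₁.fieldRange Z → c ∈ Z → Z = Set.univ}.Countable :=
    countable_setOf_not_weilGeneric_of_complexification σ₁ C₁ hdim'.le
  -- (2) image in `S` not over the generic point of `S₀`
  haveI : Countable S₀.left := countable_of_locallyOfFiniteType S₀.hom
  have hbad₂ : {c : ComplexPoints C' |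
      prS.base (AlgPoints.map δ c).pt ≠ genericPoint S₀.left}.Countable := by
    have hsub : {c : ComplexPoints C' | prS.base (AlgPoints.map δ c).pt ≠ genericPoint S₀.left} ⊆
        ⋃ x ∈ {x : S₀.left | x ≠ genericPoint S₀.left},
          {c : ComplexPoints C' | c.pt ∈ (δ.left ≫ prS).base ⁻¹' closure {x}} := by
      intro c hc
      simp only [Set.mem_setOf_eq] at hc
      simp only [Set.mem_iUnion, Set.mem_setOf_eq, exists_prop]
      refine ⟨prS.base (AlgPoints.map δ c).pt, hc, ?_⟩
      simp only [Set.mem_preimage, Scheme.Hom.comp_base, TopCat.coe_comp, Function.comp_apply]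
      exact subset_closure (Set.mem_singleton _)
    refine Set.Countable.mono hsub (Set.Countable.biUnion (Set.to_countable _) fun x hx => ?_)
    simp only [Set.mem_setOf_eq] at hx
    refine (finite_setOf_pt_mem_of_isClosed_of_ne_univ (S := C')
      (isClosed_closure.preimage (δ.left ≫ prS).continuous) fun huniv => ?_).countable
    -- the point `c₀ ↦ s` is not over `closure {x}` since `s` is over the generic point
    have hmem : c₀.pt ∈ (δ.left ≫ prS).base ⁻¹' closure {x} := by rw [huniv]; trivial
    simp only [Set.mem_preimage, Scheme.Hom.comp_base, TopCat.coe_comp, Function.comp_apply] at hmem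
    have hpt : prS.base (AlgPoints.map δ c₀).pt = genericPoint S₀.left := by rw [hc₀]; exact hs
    rw [AlgPoints.pt_map] at hpt
    change prS.base (δ.left.base c₀.pt) = genericPoint S₀.left at hpt
    rw [hpt] at hmem
    apply hx
    -- `η ∈ closure {x}` forces `x = η`
    have hspec : x ⤳ genericPoint S₀.left := specializes_iff_mem_closure.2 hmem
    have hgen : genericPoint S₀.left ⤳ x := (genericPoint_spec S₀.left).specializes trivial
    exact (hspec.antisymm hgen).eq
  -- ### a good point `c⋆`: Weil-generic over `k₁`, with image over the generic point of `S₀`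
  obtain ⟨cs, hcs⟩ : ∃ c : ComplexPoints C', c ∉ {c : ComplexPoints C' | ¬ ∀ Z : Set (ComplexPoints C'),
      IsDefinedOver σ₁ C₁ σ₁.fieldRange Z → c ∈ Z → Z = Set.univ} ∪
        {c : ComplexPoints C' | prS.base (AlgPoints.map δ c).pt ≠ genericPoint S₀.left} := by
    by_contra hall
    refine not_countable_univ_complexPoints_of_smoothCurve (S := C') c₀ ?_
    exact (hbad₁.union hbad₂).mono fun c _ => Classical.byContradiction fun hc => hall ⟨c, hc⟩
  simp only [Set.mem_union, Set.mem_setOf_eq, not_or, not_not] at hcs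
  obtain ⟨hcs₁, hcs₂⟩ := hcs
  have hcsη : prC.base cs.pt = genericPoint C₁.left :=
    base_pt_eq_genericPoint_of_isGenericPoint σ₁ C₁ hcs₁
  have hcs_dense : closure {prC.base cs.pt} = (Set.univ : Set C₁.left) := by
    rw [hcsη]; exact genericPoint_closure _
  -- `A₁` is algebraic on the fibre over `c⋆`
  have hAcs : complexBetti.map (fiberι ((baseChangeHom σ₁).map f₁) cs) (2 * p) A₁ ∈
      algebraicClasses (fiberOver ((baseChangeHom σ₁).map f₁) cs) p := by
    refine (map_fiberι_mem_algebraicClasses_iff_of_arrowIso e𝒳 eC hcomm AC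
      (s' := cs) (s := AlgPoints.map eC.hom cs) rfl).mpr ?_
    refine (hfib (AlgPoints.map eC.hom cs)).mpr ?_
    have h := hgen (AlgPoints.map δ cs) hcs₂
    rwa [show AlgPoints.map δ cs = AlgPoints.map γ (AlgPoints.map eC.hom cs) from
      AlgPoints.map_comp_apply eC.hom γ cs] at h
  -- ### everywhere propagation over the curve, and back to `u`
  have hall := everywherePropagation k₁ σ₁ f₁ hf₁ hirr' haff' hsm' hdim' p A₁ cs hcs_dense hAcs
    (AlgPoints.map eC.inv a')
  have ha : complexBetti.map (fiberι fC a') (2 * p) AC ∈ algebraicClasses (fiberOver fC a') p :=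
    (map_fiberι_mem_algebraicClasses_iff_of_arrowIso e𝒳 eC hcomm AC
      (AlgPoints.map_hom_map_inv_apply eC a')).mp hall
  have hu := (hfib a').mp ha
  rwa [ha'] at hu

end Summit.HodgeConjecture.HodgeConjecture.Theorems

end
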